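import Mathlib
import Summits.Ventures.HodgeRepro.Tier4.Line1.RTFSetting

/-!
# Tier4/Line4/TailAssembly — C-L4-TAIL as an ASSEMBLY: the `o₀`-term dominates the tail of a level family whose
off-`o₀` terms are sparse (`d ≥ c N`) and decay exponentially in a size `d` with a summable profile

Blind re-derivation cell `pub-hodge-repro`, Tier 4 (README §9–§10), seat t4-L1-p4 (gen 4), re-pointed by the lead
(R-7 S14714 / R-11 S14775) to LINE L4, cut (c) C-L4-TAIL, statement first (S14789).  Target tree path
`lean/Summits/Ventures/HodgeRepro/Tier4/Line4/TailAssembly.lean`.  Imports only Mathlib and RTFSetting.  0 print.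

THE SHAPE (plan-4 g4's §15 statements file, HOME proofs/t4-plan-4/work/v33/L1Class-STATEMENTS.lean, Part B; L4-MATH.md
§15.2): for the level family `f^{(N)} = f_{w₀} ⊗ f^{w₀}_N` the geometric side is the full sum over rational double
cosets `o`; the finite factor is non-zero only on the SPARSE coset `t(γ) ∈ t(γ₀) + NΛ`, the archimedean factor of the
weight-3 coefficient's orbital integral decays like `e^{−3 d(γ)}`, the lattice count is `≍ e^{2T}` below size `T`, and
the `γ₀`-term is a fixed non-zero number — so `∃ N₀, ∀ N ≥ N₀`, the `o₀`-term dominates the tail (plan-4's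
`TailDominatedFrom`, stated there as a HOME display).

WHAT IS PROVED — generic, over any index type `ι` (the double cosets), terms `a : ℕ → ι → ℂ`, a size `d : ι → ℝ`:
**`exists_tail_lt_of_decay`**: from (1) `hsum : Summable fun o => exp (−β d o)` (the lattice count against `β`, the
layer-cake of `#{o : d o ≤ T} ≤ C′ e^{αT}` for `β > α`), (2) `hdecay : ‖a N o‖ ≤ C e^{−(β + δ) d o}` for `o ≠ o₀`
(archimedean decay, one extra `δ > 0` of rate), (3) `hsparse : a N o ≠ 0 → c N ≤ d o` for `o ≠ o₀` (finite-place
sparsity), (4) `hmain : m ≤ ‖a N o₀‖` from some `N₁` on (the `γ₀`-term): `∃ N₀, ∀ N ≥ N₀, a N o₀ ≠ 0 ∧ Summable (a N) ∧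
‖∑' o ≠ o₀, a N o‖ < ‖a N o₀‖`.  The tail is `≤ C e^{−δ c N} · ∑ e^{−β d}` (for `o ≠ o₀` with `a N o ≠ 0`,
`e^{−(β+δ) d o} ≤ e^{−δ c N} e^{−β d o}`), which tends to `0` (`tendsto_exp_atBot`).  Then the RTF form
**`Setting.exists_orbital_tail_lt_of_decay`** (`a N o := S.orbital χ χ' o (f N)`; the conclusion is plan-4's
`TailDominatedFrom S χ χ' o₀ f` unfolded — `Iff.rfl` once the §15 defs are in the tree) and
**`Setting.J_ne_zero_of_orbital_tail`** (`J (f N) = O_{o₀} + tail` with `‖tail‖ < ‖O_{o₀}‖` ⇒ `J (f N) ≠ 0`, the `tsum`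
form of the geometric side taken as a hypothesis — plan-4's `RtfGeometricL1` for the family, displayed).

HONEST SCOPE.  This is the ASSEMBLY of §15.2, not its analytic inputs: `hsparse` (the finite-place coset sparsity,
t4-L1-p3 (R-10)(i)), `hdecay` (the orbital integral of the weight-3 integrable coefficient: Feigon–Whitehouse 2009 /
Ramakrishnan–Rogawski 2005 — PRINT), `hmain` (the `γ₀`-term bounded below uniformly in the level: the FACTOR ∘
TORUSPROD chain + ARCH) and the lattice count behind `hsum` stay DISPLAYED clauses of the line.  Nothing here says
anything about the status of the Hodge conjecture for CM abelian varieties, which is NOT proved (HC_CM is NOT proved by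
anyone in this repository).
-/

set_option autoImplicit false

noncomputable section

namespace Summit.Ventures.HodgeRepro.Tier4.Line4

open Filter Topology

section Generic

variable {ι : Type}

/-- the pointwise tail bound: off `o₀`, a term that is sparse (`c N ≤ d o` when non-zero) and decays at rate `β + δ`
is bounded by `C e^{−δ c N} · e^{−β d o}`. -/
theorem norm_le_of_sparse_decay {a : ℕ → ι → ℂ} {o₀ : ι} {d : ι → ℝ} {C β δ c : ℝ} (hC : 0 ≤ C) (hδ : 0 ≤ δ)
    (hdecay : ∀ N o, o ≠ o₀ → ‖a N o‖ ≤ C * Real.exp (-((β + δ) * d o)))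
    (hsparse : ∀ N o, o ≠ o₀ → a N o ≠ 0 → c * N ≤ d o) (N : ℕ) {o : ι} (ho : o ≠ o₀) :
    ‖a N o‖ ≤ C * Real.exp (-(δ * c * N)) * Real.exp (-(β * d o)) := by
  by_cases h0 : a N o = 0
  · rw [h0, norm_zero]
    positivity
  · have hd : c * N ≤ d o := hsparse N o ho h0
    calc ‖a N o‖ ≤ C * Real.exp (-((β + δ) * d o)) := hdecay N o ho
      _ = C * (Real.exp (-(δ * d o)) * Real.exp (-(β * d o))) := by
          rw [← Real.exp_add]
          congr 2
          ring
      _ ≤ C * (Real.exp (-(δ * c * N)) * Real.exp (-(β * d o))) := by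
          have hexp : Real.exp (-(δ * d o)) ≤ Real.exp (-(δ * c * N)) := by
            rw [Real.exp_le_exp, neg_le_neg_iff, mul_assoc]
            exact mul_le_mul_of_nonneg_left hd hδ
          exact mul_le_mul_of_nonneg_left (mul_le_mul_of_nonneg_right hexp (Real.exp_pos _).le) hC
      _ = C * Real.exp (-(δ * c * N)) * Real.exp (-(β * d o)) := by ring

/-- **C-L4-TAIL, the generic assembly**: sparse off-`o₀` terms with an exponentially decaying, summable profile are
dominated by a fixed `o₀`-term from some level on. -/
theorem exists_tail_lt_of_decay (a : ℕ → ι → ℂ) (o₀ : ι) (d : ι → ℝ) {C β δ c : ℝ} (hC : 0 ≤ C) (hδ : 0 < δ)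
    (hc : 0 < c) (hsum : Summable fun o => Real.exp (-(β * d o)))
    (hdecay : ∀ N o, o ≠ o₀ → ‖a N o‖ ≤ C * Real.exp (-((β + δ) * d o)))
    (hsparse : ∀ N o, o ≠ o₀ → a N o ≠ 0 → c * N ≤ d o)
    (hmain : ∃ m : ℝ, 0 < m ∧ ∃ N₁ : ℕ, ∀ N ≥ N₁, m ≤ ‖a N o₀‖) :
    ∃ N₀ : ℕ, ∀ N ≥ N₀, a N o₀ ≠ 0 ∧ Summable (a N) ∧
      ‖∑' o : {o : ι // o ≠ o₀}, a N o.1‖ < ‖a N o₀‖ := by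
  classical
  obtain ⟨m, hm, N₁, hN₁⟩ := hmain
  set S : ℝ := ∑' o, Real.exp (-(β * d o)) with hSdef
  have hS0 : 0 ≤ S := tsum_nonneg fun o => (Real.exp_pos _).le
  -- the tail bound for a fixed `N`
  have htail : ∀ N : ℕ, Summable (a N) ∧
      ‖∑' o : {o : ι // o ≠ o₀}, a N o.1‖ ≤ C * Real.exp (-(δ * c * N)) * S := by
    intro N
    have hpt : ∀ o : {o : ι // o ≠ o₀}, ‖a N o.1‖ ≤ C * Real.exp (-(δ * c * N)) * Real.exp (-(β * d o.1)) :=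
      fun o => norm_le_of_sparse_decay hC hδ.le hdecay hsparse N o.2
    have hmaj : Summable fun o : {o : ι // o ≠ o₀} => C * Real.exp (-(δ * c * N)) * Real.exp (-(β * d o.1)) :=
      (hsum.subtype {o | o ≠ o₀}).mul_left _
    have hnorm : Summable fun o : {o : ι // o ≠ o₀} => ‖a N o.1‖ :=
      Summable.of_nonneg_of_le (fun _ => norm_nonneg _) hpt hmaj
    have hsub : Summable fun o : {o : ι // o ≠ o₀} => a N o.1 := hnorm.of_norm
    have hall : Summable (a N) := (Set.finite_singleton o₀).summable_compl_iff.mp hsub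
    refine ⟨hall, ?_⟩
    calc ‖∑' o : {o : ι // o ≠ o₀}, a N o.1‖
        ≤ ∑' o : {o : ι // o ≠ o₀}, ‖a N o.1‖ := norm_tsum_le_tsum_norm hnorm
      _ ≤ ∑' o : {o : ι // o ≠ o₀}, C * Real.exp (-(δ * c * N)) * Real.exp (-(β * d o.1)) :=
          hnorm.tsum_le_tsum hpt hmaj
      _ = C * Real.exp (-(δ * c * N)) * ∑' o : {o : ι // o ≠ o₀}, Real.exp (-(β * d o.1)) := tsum_mul_left
      _ ≤ C * Real.exp (-(δ * c * N)) * S := by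
          gcongr
          exact Summable.tsum_subtype_le _ {o | o ≠ o₀} (fun _ => (Real.exp_pos _).le) hsum
  -- the bound tends to `0`
  have hlim : Tendsto (fun N : ℕ => C * Real.exp (-(δ * c * N)) * S) atTop (𝓝 0) := by
    have h1 : Tendsto (fun N : ℕ => -(δ * c * N)) atTop atBot := by
      refine tendsto_neg_atTop_atBot.comp ?_
      exact (tendsto_natCast_atTop_atTop (R := ℝ)).const_mul_atTop (mul_pos hδ hc)
    have h2 : Tendsto (fun N : ℕ => C * Real.exp (-(δ * c * N)) * S) atTop (𝓝 (C * 0 * S)) :=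
      ((Real.tendsto_exp_atBot.comp h1).const_mul C).mul_const S
    simpa using h2
  obtain ⟨N₂, hN₂⟩ := Filter.eventually_atTop.1 (hlim.eventually_lt_const hm)
  refine ⟨max N₁ N₂, fun N hN => ?_⟩
  have hN1 : N₁ ≤ N := le_trans (le_max_left _ _) hN
  have hN2 : N₂ ≤ N := le_trans (le_max_right _ _) hN
  have hmN : m ≤ ‖a N o₀‖ := hN₁ N hN1
  refine ⟨fun h0 => ?_, (htail N).1, lt_of_le_of_lt (htail N).2 (lt_of_lt_of_le (hN₂ N hN2) hmN)⟩
  rw [h0, norm_zero] at hmN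
  exact absurd hmN (not_le.2 hm)

end Generic

section RTF

open Summit.Ventures.HodgeRepro.Tier4.Line1.RTF

variable {G : Type} [Group G] [TopologicalSpace G] [MeasurableSpace G] (S : Setting G)

/-- a summable family indexed by the orbits splits as the `o₀`-term plus the sum over `o ≠ o₀`. -/
theorem tsum_eq_add_tsum_ne {a : S.Orbit → ℂ} (ha : Summable a) (o₀ : S.Orbit) :
    ∑' o, a o = a o₀ + ∑' o : {o : S.Orbit // o ≠ o₀}, a o.1 := by
  have h := ha.tsum_subtype_add_tsum_subtype_compl ({o₀} : Set S.Orbit)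
  rw [← h, tsum_singleton]
  rfl

/-- **C-L4-TAIL on the RTF setting**: the level family `f N` of test functions, the terms `O_o(f N)`; the conclusion
is plan-4's `TailDominatedFrom S χ χ' o₀ f` unfolded (with the summability of the family). -/
theorem Setting.exists_orbital_tail_lt_of_decay (χ : S.T → ℂ) (χ' : S.T' → ℂ) (o₀ : S.Orbit) (f : ℕ → G → ℂ)
    (d : S.Orbit → ℝ) {C β δ c : ℝ} (hC : 0 ≤ C) (hδ : 0 < δ) (hc : 0 < c)
    (hsum : Summable fun o => Real.exp (-(β * d o)))
    (hdecay : ∀ N o, o ≠ o₀ → ‖S.orbital χ χ' o (f N)‖ ≤ C * Real.exp (-((β + δ) * d o)))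
    (hsparse : ∀ N o, o ≠ o₀ → S.orbital χ χ' o (f N) ≠ 0 → c * N ≤ d o)
    (hmain : ∃ m : ℝ, 0 < m ∧ ∃ N₁ : ℕ, ∀ N ≥ N₁, m ≤ ‖S.orbital χ χ' o₀ (f N)‖) :
    ∃ N₀ : ℕ, ∀ N ≥ N₀, S.orbital χ χ' o₀ (f N) ≠ 0 ∧ (Summable fun o => S.orbital χ χ' o (f N)) ∧
      ‖∑' o : {o : S.Orbit // o ≠ o₀}, S.orbital χ χ' o.1 (f N)‖ < ‖S.orbital χ χ' o₀ (f N)‖ :=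
  exists_tail_lt_of_decay (fun N o => S.orbital χ χ' o (f N)) o₀ d hC hδ hc hsum hdecay hsparse hmain

/-- **TAIL ⇒ `J ≠ 0`**, with the `tsum` form of the geometric side DISPLAYED (plan-4's `RtfGeometricL1` for this `f`):
`J = O_{o₀} + tail` and `‖tail‖ < ‖O_{o₀}‖`. -/
theorem Setting.J_ne_zero_of_orbital_tail (χ : S.T → ℂ) (χ' : S.T' → ℂ) {f : G → ℂ} {o₀ : S.Orbit}
    (hsum : Summable fun o => S.orbital χ χ' o f) (hJ : S.J χ χ' f = ∑' o, S.orbital χ χ' o f)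
    (hT : ‖∑' o : {o : S.Orbit // o ≠ o₀}, S.orbital χ χ' o.1 f‖ < ‖S.orbital χ χ' o₀ f‖) :
    S.J χ χ' f ≠ 0 := by
  rw [hJ, tsum_eq_add_tsum_ne S hsum o₀]
  intro h0
  have h1 : S.orbital χ χ' o₀ f = -∑' o : {o : S.Orbit // o ≠ o₀}, S.orbital χ χ' o.1 f := by
    rw [eq_neg_iff_add_eq_zero]
    exact h0
  have h2 : ‖S.orbital χ χ' o₀ f‖ = ‖∑' o : {o : S.Orbit // o ≠ o₀}, S.orbital χ χ' o.1 f‖ := by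
    rw [h1, norm_neg]
  exact absurd h2 (ne_of_gt hT)

/-- **C-L4-TAIL ⇒ `J (f N) ≠ 0` from some level on**, with the `tsum` form of the geometric side displayed for every
member of the family. -/
theorem Setting.exists_J_ne_zero_of_decay (χ : S.T → ℂ) (χ' : S.T' → ℂ) (o₀ : S.Orbit) (f : ℕ → G → ℂ)
    (d : S.Orbit → ℝ) {C β δ c : ℝ} (hC : 0 ≤ C) (hδ : 0 < δ) (hc : 0 < c)
    (hsum : Summable fun o => Real.exp (-(β * d o)))
    (hdecay : ∀ N o, o ≠ o₀ → ‖S.orbital χ χ' o (f N)‖ ≤ C * Real.exp (-((β + δ) * d o)))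
    (hsparse : ∀ N o, o ≠ o₀ → S.orbital χ χ' o (f N) ≠ 0 → c * N ≤ d o)
    (hmain : ∃ m : ℝ, 0 < m ∧ ∃ N₁ : ℕ, ∀ N ≥ N₁, m ≤ ‖S.orbital χ χ' o₀ (f N)‖)
    (hgeo : ∀ N, S.J χ χ' (f N) = ∑' o, S.orbital χ χ' o (f N)) :
    ∃ N₀ : ℕ, ∀ N ≥ N₀, S.J χ χ' (f N) ≠ 0 := by
  obtain ⟨N₀, hN₀⟩ :=
    Setting.exists_orbital_tail_lt_of_decay S χ χ' o₀ f d hC hδ hc hsum hdecay hsparse hmain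
  exact ⟨N₀, fun N hN => Setting.J_ne_zero_of_orbital_tail S χ χ' (hN₀ N hN).2.1 (hgeo N) (hN₀ N hN).2.2⟩

end RTF

section Count

variable {ι : Type}

/-- **the layer-cake**: a lattice count `#{o : d o ≤ T} ≤ C′ e^{α T}` (for every `T`, a finset containing all `o` of size
`≤ T`, of cardinality `≤ C′ e^{α T}`) makes the profile `e^{−β d}` summable for every `β > α`, `β ≥ 0`: the partial
sums are bounded by `C′ e^α ∑_j (e^{α−β})^j = C′ e^α / (1 − e^{α−β})` (group the terms by `j = ⌊d o⌋₊`; the `j`-th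
layer has at most `C′ e^{α (j+1)}` terms, each `≤ e^{−β j}`). -/
theorem summable_exp_of_count (d : ι → ℝ) (hd : ∀ o, 0 ≤ d o) {α β C' : ℝ} (hαβ : α < β) (hβ : 0 ≤ β)
    (hC' : 0 ≤ C')
    (hcount : ∀ T : ℝ, ∃ s : Finset ι, (∀ o, d o ≤ T → o ∈ s) ∧ (s.card : ℝ) ≤ C' * Real.exp (α * T)) :
    Summable fun o => Real.exp (-(β * d o)) := by
  classical
  set r : ℝ := Real.exp (α - β) with hr
  have hr0 : 0 ≤ r := (Real.exp_pos _).le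
  have hr1 : r < 1 := by
    rw [hr, Real.exp_lt_one_iff]
    linarith
  have hgeo : Summable fun j : ℕ => r ^ j := summable_geometric_of_lt_one hr0 hr1
  refine summable_of_sum_le (c := C' * Real.exp α * (1 - r)⁻¹) (fun o => (Real.exp_pos _).le) fun t => ?_
  -- the layer of `o ∈ t` with `⌊d o⌋₊ = j` has at most `C′ e^{α (j+1)}` members, each term `≤ e^{−β j}`
  have hlayer : ∀ j : ℕ, ∑ o ∈ t.filter (fun o => ⌊d o⌋₊ = j), Real.exp (-(β * d o)) ≤
      C' * Real.exp α * r ^ j := by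
    intro j
    obtain ⟨s, hs, hcard⟩ := hcount ((j : ℝ) + 1)
    have hsub : t.filter (fun o => ⌊d o⌋₊ = j) ⊆ s := by
      intro o ho
      rw [Finset.mem_filter] at ho
      refine hs o ?_
      have := Nat.lt_floor_add_one (d o)
      rw [ho.2] at this
      exact this.le
    have hterm : ∀ o ∈ t.filter (fun o => ⌊d o⌋₊ = j), Real.exp (-(β * d o)) ≤ Real.exp (-(β * j)) := by
      intro o ho
      rw [Finset.mem_filter] at ho
      rw [Real.exp_le_exp, neg_le_neg_iff]
      have h1 : (j : ℝ) ≤ d o := by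
        rw [← ho.2]
        exact Nat.floor_le (hd o)
      exact mul_le_mul_of_nonneg_left h1 hβ
    calc ∑ o ∈ t.filter (fun o => ⌊d o⌋₊ = j), Real.exp (-(β * d o))
        ≤ (t.filter (fun o => ⌊d o⌋₊ = j)).card • Real.exp (-(β * j)) :=
          Finset.sum_le_card_nsmul _ _ _ hterm
      _ = ((t.filter (fun o => ⌊d o⌋₊ = j)).card : ℝ) * Real.exp (-(β * j)) := by rw [nsmul_eq_mul]
      _ ≤ (C' * Real.exp (α * ((j : ℝ) + 1))) * Real.exp (-(β * j)) := by
          refine mul_le_mul_of_nonneg_right ?_ (Real.exp_pos _).le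
          exact le_trans (by exact_mod_cast Finset.card_le_card hsub) hcard
      _ = C' * Real.exp α * r ^ j := by
          rw [hr, ← Real.exp_nat_mul, mul_assoc, ← Real.exp_add, mul_assoc, ← Real.exp_add]
          congr 2
          ring
  -- group `t` by the layers and sum the geometric series
  have hgroup : ∑ o ∈ t, Real.exp (-(β * d o)) =
      ∑ j ∈ t.image (fun o => ⌊d o⌋₊), ∑ o ∈ t.filter (fun o => ⌊d o⌋₊ = j), Real.exp (-(β * d o)) :=
    (Finset.sum_fiberwise_of_maps_to (fun o ho => Finset.mem_image_of_mem _ ho) _).symm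
  rw [hgroup]
  calc ∑ j ∈ t.image (fun o => ⌊d o⌋₊), ∑ o ∈ t.filter (fun o => ⌊d o⌋₊ = j), Real.exp (-(β * d o))
      ≤ ∑ j ∈ t.image (fun o => ⌊d o⌋₊), C' * Real.exp α * r ^ j :=
        Finset.sum_le_sum fun j _ => hlayer j
    _ = C' * Real.exp α * ∑ j ∈ t.image (fun o => ⌊d o⌋₊), r ^ j := by rw [Finset.mul_sum]
    _ ≤ C' * Real.exp α * ∑' j : ℕ, r ^ j := by
        refine mul_le_mul_of_nonneg_left ?_ (by positivity)
        exact hgeo.sum_le_tsum _ (fun j _ => pow_nonneg hr0 j)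
    _ = C' * Real.exp α * (1 - r)⁻¹ := by rw [tsum_geometric_of_lt_one hr0 hr1]

/-- **C-L4-TAIL with the lattice COUNT displayed** (L4-MATH.md §15.2 verbatim: `#{o : d o ≤ T} ≤ C′ e^{α T}` against the
decay `e^{−(β + δ) d}`, `α < β`): `J (f N) ≠ 0` from some level on. -/
theorem Setting.exists_J_ne_zero_of_count {G : Type} [Group G] [TopologicalSpace G] [MeasurableSpace G]
    (S : Summit.Ventures.HodgeRepro.Tier4.Line1.RTF.Setting G) (χ : S.T → ℂ) (χ' : S.T' → ℂ) (o₀ : S.Orbit)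
    (f : ℕ → G → ℂ) (d : S.Orbit → ℝ) (hd : ∀ o, 0 ≤ d o) {C C' α β δ c : ℝ} (hC : 0 ≤ C) (hC' : 0 ≤ C')
    (hαβ : α < β) (hβ : 0 ≤ β) (hδ : 0 < δ) (hc : 0 < c)
    (hcount : ∀ T : ℝ, ∃ s : Finset S.Orbit, (∀ o, d o ≤ T → o ∈ s) ∧ (s.card : ℝ) ≤ C' * Real.exp (α * T))
    (hdecay : ∀ N o, o ≠ o₀ → ‖S.orbital χ χ' o (f N)‖ ≤ C * Real.exp (-((β + δ) * d o)))
    (hsparse : ∀ N o, o ≠ o₀ → S.orbital χ χ' o (f N) ≠ 0 → c * N ≤ d o)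
    (hmain : ∃ m : ℝ, 0 < m ∧ ∃ N₁ : ℕ, ∀ N ≥ N₁, m ≤ ‖S.orbital χ χ' o₀ (f N)‖)
    (hgeo : ∀ N, S.J χ χ' (f N) = ∑' o, S.orbital χ χ' o (f N)) :
    ∃ N₀ : ℕ, ∀ N ≥ N₀, S.J χ χ' (f N) ≠ 0 :=
  Setting.exists_J_ne_zero_of_decay S χ χ' o₀ f d hC hδ hc (summable_exp_of_count d hd hαβ hβ hC' hcount)
    hdecay hsparse hmain hgeo

end Count

section Sparse

variable {ι : Type}

/-- **the assembly with a GENERAL sparsity scale**: `hsparse : a N o ≠ 0 → g N ≤ d o` for any `g → ∞` (the linear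
`c · N` of `exists_tail_lt_of_decay` is `g N := c * N`; the polynomial mechanism of L4-MATH.md §15.2 — coset sparsity
`|t(γ) − t(γ₀)| ≥ N` against `|t|^{−3}` — is `g N := log (1 + N)` in the exponential parametrisation `d = log (1 + |t − t₀|)`). -/
theorem exists_tail_lt_of_decay' (a : ℕ → ι → ℂ) (o₀ : ι) (d : ι → ℝ) (g : ℕ → ℝ) {C β δ : ℝ} (hC : 0 ≤ C)
    (hδ : 0 < δ) (hg : Tendsto g atTop atTop) (hsum : Summable fun o => Real.exp (-(β * d o)))
    (hdecay : ∀ N o, o ≠ o₀ → ‖a N o‖ ≤ C * Real.exp (-((β + δ) * d o)))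
    (hsparse : ∀ N o, o ≠ o₀ → a N o ≠ 0 → g N ≤ d o)
    (hmain : ∃ m : ℝ, 0 < m ∧ ∃ N₁ : ℕ, ∀ N ≥ N₁, m ≤ ‖a N o₀‖) :
    ∃ N₀ : ℕ, ∀ N ≥ N₀, a N o₀ ≠ 0 ∧ Summable (a N) ∧
      ‖∑' o : {o : ι // o ≠ o₀}, a N o.1‖ < ‖a N o₀‖ := by
  classical
  obtain ⟨m, hm, N₁, hN₁⟩ := hmain
  set S : ℝ := ∑' o, Real.exp (-(β * d o)) with hSdef
  have hS0 : 0 ≤ S := tsum_nonneg fun o => (Real.exp_pos _).le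
  -- the pointwise bound with the scale `g`
  have hpt0 : ∀ N : ℕ, ∀ o : ι, o ≠ o₀ →
      ‖a N o‖ ≤ C * Real.exp (-(δ * g N)) * Real.exp (-(β * d o)) := by
    intro N o ho
    by_cases h0 : a N o = 0
    · rw [h0, norm_zero]
      positivity
    · have hd : g N ≤ d o := hsparse N o ho h0
      calc ‖a N o‖ ≤ C * Real.exp (-((β + δ) * d o)) := hdecay N o ho
        _ = C * (Real.exp (-(δ * d o)) * Real.exp (-(β * d o))) := by
            rw [← Real.exp_add]
            congr 2
            ring
        _ ≤ C * (Real.exp (-(δ * g N)) * Real.exp (-(β * d o))) := by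
            have hexp : Real.exp (-(δ * d o)) ≤ Real.exp (-(δ * g N)) := by
              rw [Real.exp_le_exp, neg_le_neg_iff]
              exact mul_le_mul_of_nonneg_left hd hδ.le
            exact mul_le_mul_of_nonneg_left (mul_le_mul_of_nonneg_right hexp (Real.exp_pos _).le) hC
        _ = C * Real.exp (-(δ * g N)) * Real.exp (-(β * d o)) := by ring
  -- the tail bound for a fixed `N`
  have htail : ∀ N : ℕ, Summable (a N) ∧
      ‖∑' o : {o : ι // o ≠ o₀}, a N o.1‖ ≤ C * Real.exp (-(δ * g N)) * S := by
    intro N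
    have hpt : ∀ o : {o : ι // o ≠ o₀}, ‖a N o.1‖ ≤ C * Real.exp (-(δ * g N)) * Real.exp (-(β * d o.1)) :=
      fun o => hpt0 N o.1 o.2
    have hmaj : Summable fun o : {o : ι // o ≠ o₀} => C * Real.exp (-(δ * g N)) * Real.exp (-(β * d o.1)) :=
      (hsum.subtype {o | o ≠ o₀}).mul_left _
    have hnorm : Summable fun o : {o : ι // o ≠ o₀} => ‖a N o.1‖ :=
      Summable.of_nonneg_of_le (fun _ => norm_nonneg _) hpt hmaj
    have hsub : Summable fun o : {o : ι // o ≠ o₀} => a N o.1 := hnorm.of_norm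
    have hall : Summable (a N) := (Set.finite_singleton o₀).summable_compl_iff.mp hsub
    refine ⟨hall, ?_⟩
    calc ‖∑' o : {o : ι // o ≠ o₀}, a N o.1‖
        ≤ ∑' o : {o : ι // o ≠ o₀}, ‖a N o.1‖ := norm_tsum_le_tsum_norm hnorm
      _ ≤ ∑' o : {o : ι // o ≠ o₀}, C * Real.exp (-(δ * g N)) * Real.exp (-(β * d o.1)) :=
          hnorm.tsum_le_tsum hpt hmaj
      _ = C * Real.exp (-(δ * g N)) * ∑' o : {o : ι // o ≠ o₀}, Real.exp (-(β * d o.1)) := tsum_mul_left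
      _ ≤ C * Real.exp (-(δ * g N)) * S := by
          gcongr
          exact Summable.tsum_subtype_le _ {o | o ≠ o₀} (fun _ => (Real.exp_pos _).le) hsum
  -- the bound tends to `0`
  have hlim : Tendsto (fun N : ℕ => C * Real.exp (-(δ * g N)) * S) atTop (𝓝 0) := by
    have h1 : Tendsto (fun N : ℕ => -(δ * g N)) atTop atBot :=
      tendsto_neg_atTop_atBot.comp (hg.const_mul_atTop hδ)
    have h2 : Tendsto (fun N : ℕ => C * Real.exp (-(δ * g N)) * S) atTop (𝓝 (C * 0 * S)) :=
      ((Real.tendsto_exp_atBot.comp h1).const_mul C).mul_const S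
    simpa using h2
  obtain ⟨N₂, hN₂⟩ := Filter.eventually_atTop.1 (hlim.eventually_lt_const hm)
  refine ⟨max N₁ N₂, fun N hN => ?_⟩
  have hN1 : N₁ ≤ N := le_trans (le_max_left _ _) hN
  have hN2 : N₂ ≤ N := le_trans (le_max_right _ _) hN
  have hmN : m ≤ ‖a N o₀‖ := hN₁ N hN1
  refine ⟨fun h0 => ?_, (htail N).1, lt_of_le_of_lt (htail N).2 (lt_of_lt_of_le (hN₂ N hN2) hmN)⟩
  rw [h0, norm_zero] at hmN
  exact absurd hmN (not_le.2 hm)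

/-- **C-L4-TAIL with the lattice COUNT and a general sparsity scale**: `J (f N) ≠ 0` from some level on. -/
theorem Setting.exists_J_ne_zero_of_count' {G : Type} [Group G] [TopologicalSpace G] [MeasurableSpace G]
    (S : Summit.Ventures.HodgeRepro.Tier4.Line1.RTF.Setting G) (χ : S.T → ℂ) (χ' : S.T' → ℂ) (o₀ : S.Orbit)
    (f : ℕ → G → ℂ) (d : S.Orbit → ℝ) (g : ℕ → ℝ) (hd : ∀ o, 0 ≤ d o) {C C' α β δ : ℝ} (hC : 0 ≤ C) (hC' : 0 ≤ C')
    (hαβ : α < β) (hβ : 0 ≤ β) (hδ : 0 < δ) (hg : Tendsto g atTop atTop)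
    (hcount : ∀ T : ℝ, ∃ s : Finset S.Orbit, (∀ o, d o ≤ T → o ∈ s) ∧ (s.card : ℝ) ≤ C' * Real.exp (α * T))
    (hdecay : ∀ N o, o ≠ o₀ → ‖S.orbital χ χ' o (f N)‖ ≤ C * Real.exp (-((β + δ) * d o)))
    (hsparse : ∀ N o, o ≠ o₀ → S.orbital χ χ' o (f N) ≠ 0 → g N ≤ d o)
    (hmain : ∃ m : ℝ, 0 < m ∧ ∃ N₁ : ℕ, ∀ N ≥ N₁, m ≤ ‖S.orbital χ χ' o₀ (f N)‖)
    (hgeo : ∀ N, S.J χ χ' (f N) = ∑' o, S.orbital χ χ' o (f N)) :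
    ∃ N₀ : ℕ, ∀ N ≥ N₀, S.J χ χ' (f N) ≠ 0 := by
  obtain ⟨N₀, hN₀⟩ := exists_tail_lt_of_decay' (fun N o => S.orbital χ χ' o (f N)) o₀ d g hC hδ hg
    (summable_exp_of_count d hd hαβ hβ hC' hcount) hdecay hsparse hmain
  exact ⟨N₀, fun N hN => Setting.J_ne_zero_of_orbital_tail S χ χ' (hN₀ N hN).2.1 (hgeo N) (hN₀ N hN).2.2⟩

end Sparse

end Summit.Ventures.HodgeRepro.Tier4.Line4

end
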